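import Literature.AlgebraicTopology.CharacteristicClasses.ProjectiveSpaceLerayHirsch
import Literature.NumberTheory.Transcendental.AnalytificationProjProofs
import HarnessLib

/-!
# A graded basis of `H*(ℙⁿ_ℂ(ℂ); R)` in the Leray–Hirsch sense (Künneth input for `Y ⊗ ℙⁿ`)

A. Hatcher, *Algebraic Topology* (2002), Thm. 3.19 (`H*(ℂPⁿ; ℤ) = ℤ[α]/(αⁿ⁺¹)`, `|α| = 2`) in the
additive form consumed by the Künneth theorem Thm. 3.16 ("`Hᵏ(Y; R)` finitely generated free for
all `k`"): for every coefficient ring `R`, the classes `1, x, …, xⁿ ∈ H^{2j}(ℙⁿ_ℂ(ℂ); R)` — powers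
of the Euler class `x` of the tautological line bundle, read on the COMPLEX POINTS
`ComplexPoints (projectiveSpace n ℂ)` of the scheme `ℙⁿ_ℂ` (analytic topology) through Serre's
comparison homeomorphism `ℙ(ℂⁿ⁺¹) ≃ₜ ℙⁿ_ℂ(ℂ)` (GAGA §2 n°5, the tree's `isHomeomorph_projPoint`) —
form a GRADED BASIS IN THE LERAY–HIRSCH SENSE: over the one-point base the comparison map
`(aⱼ) ↦ Σⱼ aⱼ ⌣ xʲ : Π_{2j ≤ k} H^{k-2j}(pt; R) → Hᵏ(ℙⁿ_ℂ(ℂ); R)` is bijective for every `k`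
(`ComplexPoints.projectiveSpace_exists_gradedBasis`). This is the tree's PROVED Leray–Hirsch theorem
for trivial projective bundles (`projectiveSpace_lerayHirsch`, Husemoller Ch. 17 Thm. 2.5 in the
product case) over the base `pt`, transported along `ℙⁿ_ℂ(ℂ) ≃ₜ pt × ℙ(ℂⁿ⁺¹)`
(`LerayHirsch.bijective_lhMap_iff`). It is exactly the hypothesis `he` of the tree's integral
Künneth theorem for `(Y ⊗ Z)(ℂ)` (`HodgeTheory.singularCohomology_lhMap_bijective_tensor`,
`exists_eq_sum_cross_tensor`, file `HodgeTheory/CrossProductsGenericDivisibility`) with `Z = ℙⁿ_ℂ`,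
for ANY ring `R` (in particular `ℤ`: every integral class on `(Y ⊗ ℙⁿ)(ℂ)` is
`Σⱼ pr_Y^* aⱼ ⌣ pr_ℙ^* xʲ` with unique `aⱼ ∈ H^{k-2j}(Y(ℂ); ℤ)`).

Everything is proved; no definitions, no named facts.

## References

* A. Hatcher, *Algebraic Topology*, CUP 2002, §3.2 Thm. 3.16, Thm. 3.19. [HatcherAT2002]
* D. Husemoller, *Fibre Bundles*, 3rd ed. (1994), Ch. 17 §2 Thm. 2.3, Thm. 2.5.
  [HusemollerFibreBundles1994]
* J.-P. Serre, *Géométrie algébrique et géométrie analytique*, Ann. Inst. Fourier 6 (1956), §2 n°5.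
  [SerreGAGA1956]
-/

noncomputable section

open Function Literature.AlgebraicTopology.SingularHomology
  Literature.AlgebraicTopology.SingularHomology.LerayHirsch
  Literature.AlgebraicTopology.CharacteristicClasses Literature.NumberTheory.Transcendental
open scoped LinearAlgebra.Projectivization

namespace Literature.AlgebraicGeometry.Motives

/-- **`1, x, …, xⁿ` is a graded basis of `H*(ℙⁿ_ℂ(ℂ); R)` in the Leray–Hirsch sense**, for every
coefficient ring `R`: there are classes `eⱼ ∈ H^{2j}(ℙⁿ_ℂ(ℂ); R)`, `j ≤ n` (the powers of the
tautological Euler class, pulled back along Serre's homeomorphism `ℙⁿ_ℂ(ℂ) ≃ₜ ℙ(ℂⁿ⁺¹)`), such that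
over the one-point base the Leray–Hirsch comparison map
`(aⱼ) ↦ Σⱼ aⱼ ⌣ eⱼ : Π_{2j ≤ k} H^{k-2j}(pt; R) → Hᵏ(ℙⁿ_ℂ(ℂ); R)` is bijective for every `k` — Hatcher
Thm. 3.19 in additive form, i.e. the fibre hypothesis of the Künneth theorem Thm. 3.16 for
`Y × ℙⁿ(ℂ)`. [cite: HatcherAT2002, §3.2 Thm. 3.16 and Thm. 3.19]
[cite: HusemollerFibreBundles1994, Ch. 17 §2 Thm. 2.5] [cite: SerreGAGA1956, §2 n°5] -/
theorem ComplexPoints.projectiveSpace_exists_gradedBasis (R : Type) [CommRing R] (n : ℕ) :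
    ∃ e : (j : Fin (n + 1)) →
        singularCohomology R R (ComplexPoints (projectiveSpace n ℂ)) (evenDeg (n + 1) j),
      ∀ k, Bijective (lhMap R (evenDeg (n + 1))
        (ContinuousMap.const (ComplexPoints (projectiveSpace n ℂ)) PUnit.unit :
          C(ComplexPoints (projectiveSpace n ℂ), PUnit.{1})) e k) := by
  -- Serre's comparison and `ℙⁿ_ℂ(ℂ) ≃ₜ pt × ℙ(ℂⁿ⁺¹)`
  let Φ : ComplexPoints (projectiveSpace n ℂ) ≃ₜ ℙ ℂ (Fin (n + 1) → ℂ) :=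
    ((isHomeomorph_projPoint n).homeomorph (projPoint n)).symm
  let F : ComplexPoints (projectiveSpace n ℂ) ≃ₜ PUnit.{1} × ℙ ℂ (Fin (n + 1) → ℂ) :=
    Φ.trans (Homeomorph.punitProd (ℙ ℂ (Fin (n + 1) → ℂ))).symm
  let f : C(ComplexPoints (projectiveSpace n ℂ), PUnit.{1} × ℙ ℂ (Fin (n + 1) → ℂ)) := F
  -- Leray–Hirsch for the trivial projective bundle `pt × ℙ(ℂⁿ⁺¹) → pt`
  have hLH := projectiveSpace_lerayHirsch R n (Fin (n + 1) → ℂ) (by simp) PUnit.{1}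
  refine ⟨fun j ↦ singularCohomology.map R R f (evenDeg (n + 1) j)
    (projCls R (Fin (n + 1) → ℂ) PUnit.{1} (n + 1) j), fun k ↦ ?_⟩
  have hsq : (ContinuousMap.fst : C(PUnit.{1} × ℙ ℂ (Fin (n + 1) → ℂ), PUnit.{1})).comp f =
      (ContinuousMap.id PUnit.{1}).comp
        (ContinuousMap.const (ComplexPoints (projectiveSpace n ℂ)) PUnit.unit) := by
    ext
  exact (bijective_lhMap_iff R (evenDeg (n + 1)) _ _ f (ContinuousMap.id _) hsq
    (projCls R (Fin (n + 1) → ℂ) PUnit.{1} (n + 1))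
    (fun i ↦ (singularCohomology.mapIso R R F i).toLinearEquiv.bijective)
    (fun i ↦ (singularCohomology.mapIso R R (Homeomorph.refl PUnit.{1}) i).toLinearEquiv.bijective)
    k).1 (hLH k)

end Literature.AlgebraicGeometry.Motives

end
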